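import Literature.Analysis.FluidPDE.TorusNSLinearisationRemainderH1
import HarnessLib

/-!
# The linearisation `DG(u)[w]` of the projected Navier–Stokes vector field is bounded in `H¹` by the Gevrey
# level of `w`, on Gevrey balls of `T³`

Analysis/FluidPDE proof file (theorems only; no definitions, no named facts), sequel of
`TorusNSLinearisationRemainderH1.lean`.  For `DG(u)[w] = P(νΔw − (u·∇)w − (w·∇)u)` (`P v = v − ∇Δ⁻¹div v`) we
prove (`Torus.exists_h1_leray_linearisation_le`, `card d = 3`): for `u` in a Gevrey ball of radius `σ₁` and a
zero-mean smooth `w` with `∑_{k∈S} e^{2σ₂|k|}‖ŵ(k)‖² ≤ D`,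

  `∫‖DG(u)[w]‖² + ‖∇ DG(u)[w]‖₂² ≤ K D`,   `K = K(ν, σ₁, C₁, σ₂)`:

`P` contracts `L²` and `‖∇·‖₂`, the unprojected field is `O(‖w‖²_{H³})` in `H¹` (`Torus.h1_linearisation_le`) and the
`H³`-sum of `w` is at most `D ∑ₖ (1 + |k|²)³ e^{-2σ₂|k|}` on the Gevrey ball
(`Torus.sum_one_add_freqNormSq_pow_mul_norm_sq_le_of_gevreyBound`).  This is the boundedness (linear in the Gevrey level,
hence in `‖h‖²` along difference quotients) of the operator `h ↦ DG(u)[w_h]`, the mixed derivative `∂_y∂ₜ` of the smooth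
model of the NS semiflow.

## References

* P. Constantin, C. Foias, *Navier–Stokes Equations*, Univ. Chicago Press 1988, Ch. 14. [ConstantinFoiasNSE1988]
* C. Foias, R. Temam, J. Funct. Anal. 87 (1989), 359–369 (Gevrey classes). [FoiasTemam1989]
-/

noncomputable section

open _root_.MeasureTheory Set Filter Function UnitAddTorus
open scoped InnerProductSpace ContDiff Topology BigOperators

namespace Literature.Analysis.FluidPDE

namespace Torus

open Literature.Analysis.FunctionSpaces Literature.Analysis.FunctionSpaces.Torus

variable {d : Type*} [Fintype d] [DecidableEq d]

/-- **`H¹` bound of `DG(u)[w] = P(νΔw − (u·∇)w − (w·∇)u)` by the Gevrey level of `w`** on Gevrey balls of `T³`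
(`card d = 3`): there is `K = K(ν, σ₁, C₁, σ₂) ≥ 0` with `∫‖DG(u)[w]‖² + ‖∇DG(u)[w]‖₂² ≤ K D` for smooth `u` with
`∑_{k∈S} e^{2σ₁|k|}‖û(k)‖² ≤ C₁` and smooth zero-mean `w` with `∑_{k∈S} e^{2σ₂|k|}‖ŵ(k)‖² ≤ D` (all finite `S`).
[cite: ConstantinFoiasNSE1988, Ch. 14 Lemma 14.3 (14.10)] -/
theorem exists_h1_leray_linearisation_le [Nonempty d] (hd : Fintype.card d = 3) (ν σ₁ C₁ σ₂ : ℝ) (hσ₁ : 0 < σ₁)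
    (hσ₂ : 0 < σ₂) :
    ∃ K : ℝ, 0 ≤ K ∧ ∀ (u w : UnitAddTorus d → EuclideanSpace ℝ d), IsSmooth u → IsSmooth w → HasZeroMean w →
      (∀ S : Finset (d → ℤ), ∑ k ∈ S, Real.exp (2 * σ₁ * Real.sqrt (freqNormSq k)) *
        ‖mFourierCoeff (EuclideanSpace.complexify ∘ u) k‖ ^ 2 ≤ C₁) →
      ∀ D : ℝ, (∀ S : Finset (d → ℤ), ∑ k ∈ S, Real.exp (2 * σ₂ * Real.sqrt (freqNormSq k)) *
        ‖mFourierCoeff (EuclideanSpace.complexify ∘ w) k‖ ^ 2 ≤ D) →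
      (∫ x, ‖(ν • laplacian w x - (convect u w x + convect w u x)) -
          Torus.gradient (invLaplacian (divergence fun y => ν • laplacian w y - (convect u w y + convect w u y))) x‖ ^ 2) +
        gradNormSq (fun x => (ν • laplacian w x - (convect u w x + convect w u x)) -
          Torus.gradient (invLaplacian (divergence fun y => ν • laplacian w y - (convect u w y + convect w u y))) x) ≤
        K * D := by
  obtain ⟨B, hB⟩ := exists_sobolevBounds_of_gevreyBound (d := d) hσ₁ C₁
  obtain ⟨K₃, hK₃pos, hK₃⟩ := norm_sq_le_gradNormSq_add_of_hasZeroMean hd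
  set KA : ℝ := 2 * ν ^ 2 * ((4 * Real.pi ^ 2) ^ 2 + (4 * Real.pi ^ 2) ^ 3) +
    2 * (18 * B ^ 2 + (6 * B ^ 2 + 72 * B ^ 2) * (4 * Real.pi ^ 2) + 12 * B ^ 2 * (4 * Real.pi ^ 2) ^ 2 +
      12 * K₃ * (4 * Real.pi ^ 2 + (4 * Real.pi ^ 2) ^ 2) * B) with hKA
  set Y₃ : ℝ := ∑' k : d → ℤ, (1 + freqNormSq k) ^ 3 * Real.exp (-(2 * σ₂ * Real.sqrt (freqNormSq k))) with hY₃
  have hY₃0 : 0 ≤ Y₃ := tsum_nonneg fun k => mul_nonneg (one_add_freqNormSq_pow_nonneg k 3) (Real.exp_pos _).le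
  refine ⟨max KA 0 * Y₃, by positivity, fun u w hu hw hwz hGu D hGw => ?_⟩
  obtain ⟨hM, hΛ, -, hY, -, -⟩ := hB u hu hGu
  have hD0 : 0 ≤ D := gevreyBound_nonneg hGw
  -- the `H³`-sum of `w` on the Gevrey ball
  have hε : ∀ S : Finset (d → ℤ), ∑ k ∈ S, (1 + freqNormSq k) ^ 3 *
      ‖mFourierCoeff (EuclideanSpace.complexify ∘ w) k‖ ^ 2 ≤ D * Y₃ := fun S =>
    sum_one_add_freqNormSq_pow_mul_norm_sq_le_of_gevreyBound hσ₂ hGw 3 S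
  -- the unprojected field
  have hlin := h1_linearisation_le hd (ν := ν) hu hM hΛ hY hK₃ hK₃pos.le hw hwz hε
  -- contraction of `P`
  have hYs : IsSmooth (fun y => ν • laplacian w y - (convect u w y + convect w u y)) :=
    (hw.laplacian.smul ν).sub ((hu.convect hw).add (hw.convect hu))
  have h1 := integral_norm_sq_sub_gradient_invLaplacian_divergence_le hYs
  have h2 := gradNormSq_sub_gradient_invLaplacian_divergence_le hYs
  have hfin : (2 * ν ^ 2 * ((4 * Real.pi ^ 2) ^ 2 + (4 * Real.pi ^ 2) ^ 3) +
      2 * (18 * B ^ 2 + (6 * B ^ 2 + 72 * B ^ 2) * (4 * Real.pi ^ 2) + 12 * B ^ 2 * (4 * Real.pi ^ 2) ^ 2 +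
        12 * K₃ * (4 * Real.pi ^ 2 + (4 * Real.pi ^ 2) ^ 2) * B)) * (D * Y₃) ≤ max KA 0 * Y₃ * D := by
    rw [← hKA, show max KA 0 * Y₃ * D = max KA 0 * (D * Y₃) by ring]
    exact mul_le_mul_of_nonneg_right (le_max_left KA 0) (mul_nonneg hD0 hY₃0)
  linarith

end Torus

end Literature.Analysis.FluidPDE

end
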